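import Summits.NavierStokesRegularity.NavierStokesRegularity.Theorems.HubbleDynamoNoSelfExcitedDynamoBackusRegime
import HarnessLib

/-!
# Crux `NoSelfExcitedDynamo` (stmt-NavierStokesRegularity-1934), line `registered`:
# stub `stub_forwardVanishing` — forward uniqueness from an identically zero past

Theorems file (`--supports stmt-NavierStokesRegularity-1934`; theorems only, sorry-free). Let `(U, P)`
be an ETERNAL classical solution of Leray's backward system
`∂ₛU + ½U + ½(y·∇)U + (U·∇)U + ∇P = ΔU`, `div U = 0` on `ℝ × ℝ³` (`IsBackwardLeraySolutionOn univ 1 U P`)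
in the uniform profile class `(1 + ‖y‖)^{k+1} ‖DᵏU(s, ·)(y)‖ ≤ K_k`. If `U(s, ·) = 0` for every
`s ≤ s₀`, then `U ≡ 0`.

## Proof

The order-zero profile bound gives the crude amplitude bound `‖U‖ ≤ C₀ := max K₀ 1`, and the landed
enstrophy balance `stub_enstrophyBalance` with this `C₀ ≥ 1` reads, for the bounded nonnegative
enstrophy `E(s) = ∫ ‖curl U(s)‖² ≤ M`,
`E(b) ≤ E(a) + c ∫_a^b E` for `a ≤ b`, with `c = ½(C₀² − 1) ≥ 0` — a FORWARD Grönwall inequality.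
Since `E = 0` on `s ≤ s₀`, an elementary iteration kills `E` (`forwardVanishing_gronwall`): with a step
`h = 1/(2c + 2)` (so `c h ≤ ½`), if `E = 0` on `s ≤ a` then on `[a, a + h]` one has
`E ≤ M ⇒ E ≤ c h M ≤ M/2 ⇒ E ≤ M/4 ⇒ …`, i.e. `E ≤ M/2ᵏ` for every `k`, so `E = 0` on `s ≤ a + h`;
by induction `E = 0` on `s ≤ s₀ + n h` for every `n`, hence everywhere (no continuity or
measurability of `E` is needed: the interval integral of a non-integrable function is `0`). Then the
continuous nonnegative integrand `‖curl U(s)‖²` with zero integral vanishes pointwise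
(`backusRegime_eq_zero_of_integral_sq_norm_eq_zero`), and the curl-free Liouville theorem
`stub_curlFreeLiouville` (KNSS 2009, Lemma 3.1) gives `U ≡ 0`.
-/

noncomputable section

-- the mandated stub namespace repeats `NavierStokesRegularity` (tree precedent for this crux's stubs)
set_option linter.dupNamespace false

namespace Summit.NavierStokesRegularity.NavierStokesRegularity.Theorems.NoSelfExcitedDynamo.Registered

open Set MeasureTheory Filter Topology
open scoped ContDiff
open Literature.Analysis.FluidPDE

/-- An interval integral over `a ≤ t` of a function bounded above by `B ≥ 0` on `[a, t]` is at most
`(t - a) * B` — whatever its integrability (a non-integrable function has interval integral `0`). -/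
theorem forwardVanishing_integral_le (E : ℝ → ℝ) {a t B : ℝ} (hat : a ≤ t) (hB : 0 ≤ B)
    (hE : ∀ s ∈ Icc a t, E s ≤ B) : ∫ s in a..t, E s ≤ (t - a) * B := by
  by_cases hi : IntervalIntegrable E volume a t
  · calc ∫ s in a..t, E s ≤ ∫ _ in a..t, B :=
          intervalIntegral.integral_mono_on hat hi intervalIntegrable_const hE
      _ = (t - a) * B := by simp only [intervalIntegral.integral_const, smul_eq_mul]
  · rw [intervalIntegral.integral_undef hi]
    exact mul_nonneg (by linarith) hB

/-- **Forward Grönwall lemma from a zero past.** A nonnegative function `E ≤ M` on `ℝ` with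
`E b - E a ≤ c * ∫ s in a..b, E s` for all `a ≤ b` (`c ≥ 0`) which vanishes on a half-line `s ≤ s₀`
vanishes identically: with `h = 1/(2c + 2)`, if `E = 0` on `s ≤ a` then `E ≤ M / 2ᵏ` on `[a, a + h]`
for every `k` (induction: `E t ≤ c (t − a) M/2ᵏ ≤ M/2ᵏ⁺¹`), so `E = 0` on `s ≤ a + h`; iterate. -/
theorem forwardVanishing_gronwall (E : ℝ → ℝ) (c M s₀ : ℝ) (hc : 0 ≤ c) (hE0 : ∀ s, 0 ≤ E s)
    (hEM : ∀ s, E s ≤ M) (hinc : ∀ a b : ℝ, a ≤ b → E b - E a ≤ c * ∫ s in a..b, E s)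
    (hpast : ∀ s ≤ s₀, E s = 0) : ∀ s, E s = 0 := by
  -- step length `h` with `c * h ≤ 1/2`
  set h : ℝ := 1 / (2 * c + 2) with hh
  have hpos : 0 < h := by positivity
  have hch : c * h ≤ 1 / 2 := by
    rw [hh, mul_one_div, div_le_iff₀ (by positivity)]
    linarith
  have hM : 0 ≤ M := (hE0 s₀).trans (hEM s₀)
  -- one step of length `h`
  have step : ∀ a, (∀ s ≤ a, E s = 0) → ∀ s ≤ a + h, E s = 0 := by
    intro a ha
    have key : ∀ k : ℕ, ∀ t ∈ Icc a (a + h), E t ≤ M / 2 ^ k := by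
      intro k
      induction k with
      | zero => intro t _; simpa using hEM t
      | succ k ih =>
        intro t ht
        have h1 := hinc a t ht.1
        have h2 : ∫ s in a..t, E s ≤ (t - a) * (M / 2 ^ k) :=
          forwardVanishing_integral_le E ht.1 (by positivity) fun s hs => ih s ⟨hs.1, hs.2.trans ht.2⟩
        rw [ha a le_rfl, sub_zero] at h1
        calc E t ≤ c * ((t - a) * (M / 2 ^ k)) := h1.trans (mul_le_mul_of_nonneg_left h2 hc)
          _ ≤ c * (h * (M / 2 ^ k)) := by gcongr; linarith [ht.2]
          _ = (c * h) * (M / 2 ^ k) := by ring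
          _ ≤ (1 / 2) * (M / 2 ^ k) := by gcongr
          _ = M / 2 ^ (k + 1) := by rw [pow_succ]; ring
    intro s hs
    rcases le_or_gt s a with hsa | hsa
    · exact ha s hsa
    · have hsI : s ∈ Icc a (a + h) := ⟨hsa.le, hs⟩
      have hlim : Tendsto (fun k : ℕ => M / 2 ^ k) atTop (𝓝 0) :=
        tendsto_const_nhds.div_atTop (tendsto_pow_atTop_atTop_of_one_lt one_lt_two)
      exact le_antisymm (ge_of_tendsto' hlim fun k => key k s hsI) (hE0 s)
  -- iterate the step
  have iter : ∀ n : ℕ, ∀ s ≤ s₀ + n * h, E s = 0 := by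
    intro n
    induction n with
    | zero => simpa using hpast
    | succ n ih =>
      intro s hs
      exact step (s₀ + n * h) ih s (by push_cast at hs; linarith)
  intro s
  obtain ⟨n, hn⟩ := exists_nat_ge ((s - s₀) / h)
  exact iter n s (by rw [div_le_iff₀ hpos] at hn; linarith)

/-- **Stub `stub_forwardVanishing`** (forward uniqueness from an identically zero past, inside the
uniform profile class). An eternal classical solution `(U, P)` of Leray's backward system on `ℝ × ℝ³`
in the profile class `(1 + ‖y‖)^{k+1} ‖DᵏU(s, ·)(y)‖ ≤ K_k` with `U(s, ·) = 0` for all `s ≤ s₀`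
vanishes identically: the enstrophy balance (`stub_enstrophyBalance`, amplitude `C₀ = max K₀ 1`) is a
forward Grönwall inequality for the bounded enstrophy, which vanishes in the past, hence everywhere
(`forwardVanishing_gronwall`); so `curl U ≡ 0` (`backusRegime_eq_zero_of_integral_sq_norm_eq_zero`)
and the curl-free Liouville theorem `stub_curlFreeLiouville` finishes. -/
theorem stub_forwardVanishing :
    ∀ (U : ℝ → EuclideanSpace ℝ (Fin 3) → EuclideanSpace ℝ (Fin 3)) (P : ℝ → EuclideanSpace ℝ (Fin 3) → ℝ),
      IsBackwardLeraySolutionOn univ 1 U P →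
      (∀ k : ℕ, ∃ K : ℝ, ∀ s y, (1 + ‖y‖) ^ (k + 1) * ‖iteratedFDeriv ℝ k (U s) y‖ ≤ K) →
      ∀ s₀ : ℝ, (∀ s ≤ s₀, ∀ y, U s y = 0) → ∀ s y, U s y = 0 := by
  intro U P hL hprof s₀ hpast
  obtain ⟨K₀, hK₀⟩ := hprof 0
  -- the crude amplitude bound `‖U‖ ≤ C₀ := max K₀ 1`
  set C₀ : ℝ := max K₀ 1 with hC₀
  have hb : ∀ s y, ‖U s y‖ ≤ C₀ := fun s y => by
    have h1 : (1 + ‖y‖) * ‖U s y‖ ≤ K₀ := by simpa [norm_iteratedFDeriv_zero] using hK₀ s y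
    have h2 : ‖U s y‖ ≤ K₀ := by nlinarith [norm_nonneg (U s y), norm_nonneg y]
    exact h2.trans (le_max_left _ _)
  have hC₀1 : 1 ≤ C₀ := le_max_right _ _
  have hc : 0 ≤ (C₀ ^ 2 - 1) / 2 := by nlinarith
  obtain ⟨hint, ⟨M, hM⟩, hincr⟩ := stub_enstrophyBalance U P C₀ hL hprof hb
  -- the enstrophy vanishes in the past ...
  have hEpast : ∀ s ≤ s₀, (∫ y, ‖curl (U s) y‖ ^ 2) = 0 := by
    intro s hs
    have hU0 : U s = 0 := funext fun y => hpast s hs y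
    simp [hU0]
  -- ... hence at every similarity time (forward Grönwall)
  have hE : ∀ s, (∫ y, ‖curl (U s) y‖ ^ 2) = 0 :=
    forwardVanishing_gronwall (fun s => ∫ y, ‖curl (U s) y‖ ^ 2) ((C₀ ^ 2 - 1) / 2) M s₀ hc
      (fun s => integral_nonneg fun y => sq_nonneg _) hM
      (fun a b hab => by
        have h1 := hincr a b hab
        have h2 : -((1 - C₀ ^ 2) / 2) = (C₀ ^ 2 - 1) / 2 := by ring
        rwa [h2] at h1)
      hEpast
  -- hence the vorticity vanishes
  have hcurl : ∀ s y, curl (U s) y = 0 := by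
    intro s
    have hUs : ContDiff ℝ ∞ (U s) := hL.smooth_velocity.contDiff_slice (mem_univ s)
    have hΩc : Continuous (curl (U s)) :=
      (contDiff_curl (n := 0) (hUs.of_le (by norm_cast))).continuous
    exact backusRegime_eq_zero_of_integral_sq_norm_eq_zero hΩc (hint s) (hE s)
  exact stub_curlFreeLiouville U P hL hprof hcurl

end Summit.NavierStokesRegularity.NavierStokesRegularity.Theorems.NoSelfExcitedDynamo.Registered

end
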